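import Literature.Geometry.Kaehler.ComplexTorusPicardNumberOneProductHodge
import Literature.Geometry.Kaehler.ComplexTorusHodgeLieAlgebraRatProductHomomorphisms
import Literature.Geometry.Kaehler.ComplexTorusHodgeGroupProductGoursat
import Literature.Geometry.Kaehler.ComplexTorusAbelianSurfaceStablyNondegenerate
import Literature.Geometry.Kaehler.ComplexTorusDivisorClassesEllipticPowerNonCM
import Literature.Geometry.Kaehler.ComplexTorusSubtorusCycleClass
import Literature.Geometry.Kaehler.ComplexTorusLefschetzGroupFiniteProduct
import Literature.Geometry.Kaehler.ComplexTorusPicardNumber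
import HarnessLib

/-!
# A Hodge-general abelian variety times a SMALL factor: `Hg(X₁ × X₂) = Sp × Hg(X₂)`, `Hom = 0`, `ρ` additive and
# condition (D) on all powers whenever `(2 dim X₂)² ≤ dim X₁ (2 dim X₁ + 1)`; every abelian surface against a
# Hodge-general threefold; the explicit abelian fivefolds `X_3^L × S`, `S` ANY abelian surface

Layer `Literature/Geometry/Kaehler`, namespace `Literature.Geometry.Kaehler.ComplexTorus`; lane `lit-hodgefound`
(Track 2, Layer A4), seat `lit-hodgefound-skel-4`, row A4-125 of `run/shared/lean/pub/lit-hodgefound/SKELETON.md`.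
THEOREMS ONLY (no `def`, no named fact, no instance, no notation; net debt `0`).

Moonen–Zarhin (3.1) / Gordon's lemma (Gordon 1997, §2.16): if `Hg(X₁) = Sp_{2g₁}` (simple Lie algebra of dimension
`g₁(2g₁+1)`) and `dim Hg(X₂) < g₁(2g₁+1)`, the Hodge group of the product splits, `Hg(X₁ × X₂) = Hg(X₁) × Hg(X₂)` — the
tree's `hodgeGroupC_prod_eq_blockDiagProd_of_eq_symplecticGroupC_of_zdim_lt` — and then (Hazama, Gordon Thm. 7.6.2)
condition (D) passes from the factors to all powers of the product. Since `dim Hg(X₂) ≤ (2g₂)² − 1` for EVERY complex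
torus `X₂` of dimension `g₂` (`zdim_map_toGL_hodgeGroupC_le`), the purely numerical condition
**`(2g₂)² ≤ g₁(2g₁+1)`** suffices: `g₂ = 1, g₁ ≥ 2`; `g₂ = 2, g₁ ≥ 3`; `g₂ = 3, g₁ ≥ 4`; … . This file records that
corollary and its consequences (`Hom_ℚ(X₁, X₂) = 0 = Hom_ℚ(X₂, X₁)`, `ρ(X₁ × X₂) = ρ(X₁) + ρ(X₂)`, (D) on all powers, the
cycle form `A = B` for inner-product tori isogenous to powers), then feeds in the tree's theorem that EVERY abelian
surface satisfies (D) (`IsAbelianVariety.forall_divisorClasses_powPeriod_eq_hodgeClasses_of_finrank_eq_two`, Moonen–Zarhin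
§3) and the explicit Hodge-general threefold `X_3^L` (rows A4-115 … A4-122: `End_ℚ = ℚ`, `Hg = Sp₆`, (D)):
**for EVERY complex abelian surface `S` — simple or not, with or without complex multiplication — every power of the
abelian fivefold `X_3^L × S` has its Hodge ring generated by divisor classes, every inner-product torus isogenous to such
a power satisfies the Hodge `(p,p)`-conjecture in cycle form, `Hom(X_3^L, S) = 0` and `ρ(X_3^L × S) = 1 + ρ(S)`.**
Also: `X_g^L × E_τ` for every elliptic curve `E_τ` and `g ∈ {2, 3}`.

## Sources, verbatim

* B. Moonen, Yu. G. Zarhin, *Hodge classes on abelian varieties of low dimension*, Math. Ann. 315 (1999) [held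
  arXiv:math/9901113]: §3 (3.1) [p0006 L52–L60] "`Hg(X₁ × X₂) ≠ Hg(X₁) × Hg(X₂)` … iff … the Hodge ring `B•(X₁^m × X₂^n)`
  is not generated by the elements coming from `B•(X₁^m)` and `B•(X₂^n)`"; Thm. (3.2) (1) [p0006 L69–L74] (Hazama);
  §3 [p0008 L108–L111] "for every complex abelian variety `X` of dimension `≤ 3` we have `Hg(X) = Sp_D(V,φ)` and
  condition (D) in (1.5) is satisfied" (abelian surfaces); §1 [p0002 L108] `Hg(X) ⊂ Sp(V, φ)`.
* B. B. Gordon, *A survey of the Hodge conjecture for abelian varieties* (1997/1999), §2.16 Proposition (Goursat /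
  dimension argument), Thm. 7.5, Thm. 7.6.2, 7.6.1.
* H. Lange, *Abelian Varieties over the Complex Numbers* (2023), §7.3.1 Thm. 7.3.1, Prop. 7.3.2 and p. 336; §7.3.3
  Exercise (1)(b), (3)(a); §2.4.4 Cor. 2.4.26.
* K. Hulek, R. Laface, *On the Picard numbers of abelian varieties* (2019), §2.1 Cor. 2.3
  (`ρ(X₁ × X₂) = ρ(X₁) + ρ(X₂) + rank Hom(X₁, X₂)`), §6.2 Prop. 6.4 (`X_g^L`).

## References

* [MoonenZarhin1999LowDim] B. Moonen, Yu. G. Zarhin, Math. Ann. 315 (1999) 711–733, §1, §3 (3.1), Thm. (3.2), (3.10)–(3.11).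
* [Gordon1997] B. B. Gordon, *A survey of the Hodge conjecture for abelian varieties*, arXiv:alg-geom/9709030, §2.16
  Proposition, 7.5, 7.6.
* [Gordon1999HodgeAVSurvey] the same, Appendix B in J. D. Lewis, *A Survey of the Hodge Conjecture*, 2nd ed. (1999).
* [Lange2023AbelianVarietiesComplex] H. Lange, *Abelian Varieties over the Complex Numbers*, Springer (2023), §7.3.1,
  §7.3.3 Exercise (1), (3), §2.4.4 Cor. 2.4.26.
* [HulekLaface2019PicardNumbersAV] K. Hulek, R. Laface, Ann. Sc. Norm. Super. Pisa (5) XIX (2019), §2.1 Cor. 2.3, §6.2 Prop. 6.4.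
-/

noncomputable section

open scoped Manifold
open Module Matrix Set Function
open Complex (I ofReal)
open Literature.NumberTheory.Automorphic (IsZConnected)

universe u

namespace Literature.Geometry.Kaehler

namespace ComplexTorus

/-! ## §1 `Hg(X₁) = Sp_{2g₁}` and `(2g₂)² ≤ g₁(2g₁+1)`: the Hodge group splits, `Hom = 0`, (D) on all powers -/

section SmallFactor

variable {l : Type*} [Fintype l] [DecidableEq l] {ι₂ : Type*} [Fintype ι₂] [DecidableEq ι₂]
  {E₁ E₂ : Type*} [NormedAddCommGroup E₁] [NormedSpace ℂ E₁] [NormedAddCommGroup E₂] [NormedSpace ℂ E₂]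
  (Φ₁ : ((l ⊕ l) → ℝ) ≃L[ℝ] E₁) (Φ₂ : (ι₂ → ℝ) ≃L[ℝ] E₂)

omit [DecidableEq l] in
/-- **`dim Hg(X₂) < g₁(2g₁+1)` as soon as `(2g₂)² ≤ g₁(2g₁+1)`**, for every complex torus `X₂` with lattice rank
`2g₂ = |ι₂| ≥ 1` (`dim Hg(X₂) ≤ (2g₂)² − 1`, the tree's `zdim_map_toGL_hodgeGroupC_le`).
[cite: MoonenZarhin1999LowDim, §1 (p0002 L108)] [cite: Gordon1997, §2.16 Proposition] -/
theorem zdim_map_toGL_hodgeGroupC_lt_of_card_sq_le [Nonempty ι₂]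
    (hcard : Fintype.card ι₂ ^ 2 ≤ Fintype.card l * (2 * Fintype.card l + 1)) :
    (isZConnected_map_toGL_hodgeGroupC Φ₂).zdim < Fintype.card l * (2 * Fintype.card l + 1) := by
  have h1 := zdim_map_toGL_hodgeGroupC_le Φ₂
  have h2 : 0 < Fintype.card ι₂ := Fintype.card_pos
  have h3 : 0 < Fintype.card ι₂ ^ 2 := pow_pos h2 2
  omega

variable [Nonempty l] [Nonempty ι₂] [FiniteDimensional ℂ E₁] {η₁ : E₁ [⋀^Fin 2]→L[ℝ] ℝ}

/-- **`Hg(X₁ × X₂)(ℂ) = Hg(X₁)(ℂ) × Hg(X₂)(ℂ)` for a stably nondegenerate polarised `X₁` with `End_ℚ(X₁) = ℚ` (so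
`Hg(X₁) = Sp_{2g₁}`) and ANY complex torus `X₂` with `(2g₂)² ≤ g₁(2g₁+1)`** (Goursat: `𝔰𝔭_{2g₁}` is simple of dimension
`g₁(2g₁+1) > dim Hg(X₂)`). [cite: MoonenZarhin1999LowDim, §3 (3.1)] [cite: Gordon1997, §2.16 Proposition]
[cite: Lange2023AbelianVarietiesComplex, §7.3.1 Prop. 7.3.2] -/
theorem IsRiemannForm.hodgeGroupC_prod_eq_blockDiagProd_of_endAlgRat_eq_bot_of_card_sq_le (hη₁ : IsRiemannForm Φ₁ η₁)
    (hG₁ : (Matrix.J l ℚ).map (Rat.cast : ℚ → ℝ) = latticeGram Φ₁ η₁) (hE₁ : endAlgRat Φ₁ = ⊥)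
    (hX₁ : ∀ k p, divisorClasses (powPeriod Φ₁ k) p = hodgeClasses (powPeriod Φ₁ k) p)
    (hcard : Fintype.card ι₂ ^ 2 ≤ Fintype.card l * (2 * Fintype.card l + 1)) :
    hodgeGroupC (prodPeriod Φ₁ Φ₂) = blockDiagProd (hodgeGroupC Φ₁) (hodgeGroupC Φ₂) :=
  hodgeGroupC_prod_eq_blockDiagProd_of_eq_symplecticGroupC_of_zdim_lt Φ₁ Φ₂
    (hη₁.hodgeGroupC_eq_symplecticGroupC_of_forall_divisorClasses_eq_hodgeClasses hG₁ hE₁ hX₁)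
    (zdim_map_toGL_hodgeGroupC_lt_of_card_sq_le Φ₂ hcard)

/-- **`Hom_ℚ(X₁, X₂) = 0`** under the same hypotheses (a split Hodge group forces `Hom = 0`, Moonen–Zarhin Prop. (3.8)).
[cite: MoonenZarhin1999LowDim, §3 (3.1) and Prop. (3.8)] [cite: Gordon1997, §2.16 Proposition] -/
theorem IsRiemannForm.homRat_eq_bot_of_endAlgRat_eq_bot_of_card_sq_le (hη₁ : IsRiemannForm Φ₁ η₁)
    (hG₁ : (Matrix.J l ℚ).map (Rat.cast : ℚ → ℝ) = latticeGram Φ₁ η₁) (hE₁ : endAlgRat Φ₁ = ⊥)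
    (hX₁ : ∀ k p, divisorClasses (powPeriod Φ₁ k) p = hodgeClasses (powPeriod Φ₁ k) p)
    (hcard : Fintype.card ι₂ ^ 2 ≤ Fintype.card l * (2 * Fintype.card l + 1)) : homRat Φ₁ Φ₂ = ⊥ :=
  homRat_eq_bot_of_hodgeGroupC_prod_eq_blockDiagProd Φ₁ Φ₂
    (hη₁.hodgeGroupC_prod_eq_blockDiagProd_of_endAlgRat_eq_bot_of_card_sq_le Φ₁ Φ₂ hG₁ hE₁ hX₁ hcard)

/-- **`Hom_ℚ(X₂, X₁) = 0`** likewise. [cite: MoonenZarhin1999LowDim, §3 (3.1) and Prop. (3.8)] [cite: Gordon1997, §2.16 Proposition] -/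
theorem IsRiemannForm.homRat_eq_bot_of_endAlgRat_eq_bot_of_card_sq_le' (hη₁ : IsRiemannForm Φ₁ η₁)
    (hG₁ : (Matrix.J l ℚ).map (Rat.cast : ℚ → ℝ) = latticeGram Φ₁ η₁) (hE₁ : endAlgRat Φ₁ = ⊥)
    (hX₁ : ∀ k p, divisorClasses (powPeriod Φ₁ k) p = hodgeClasses (powPeriod Φ₁ k) p)
    (hcard : Fintype.card ι₂ ^ 2 ≤ Fintype.card l * (2 * Fintype.card l + 1)) : homRat Φ₂ Φ₁ = ⊥ :=
  homRat_eq_bot_of_hodgeGroupC_prod_eq_blockDiagProd' Φ₁ Φ₂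
    (hη₁.hodgeGroupC_prod_eq_blockDiagProd_of_endAlgRat_eq_bot_of_card_sq_le Φ₁ Φ₂ hG₁ hE₁ hX₁ hcard)

/-- **(D) ON ALL POWERS OF `X₁ × X₂`**: `X₁` stably nondegenerate, polarised with Gram `J`, `End_ℚ(X₁) = ℚ`; `X₂` ANY
stably nondegenerate torus with `(2g₂)² ≤ g₁(2g₁+1)` ⟹ `Dᵖ((X₁ × X₂)ᵏ) = Bᵖ((X₁ × X₂)ᵏ)` for all `k, p` (Hazama–Murty
through the split Hodge group). [cite: MoonenZarhin1999LowDim, §3 (3.1) and Thm. (3.2) (1)] [cite: Gordon1999HodgeAVSurvey, Thm. 7.5 and Thm. 7.6.2]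
[cite: Gordon1997, §2.16 Proposition] -/
theorem IsRiemannForm.forall_divisorClasses_powPeriod_prod_eq_hodgeClasses_of_endAlgRat_eq_bot_of_card_sq_le
    (hη₁ : IsRiemannForm Φ₁ η₁) (hG₁ : (Matrix.J l ℚ).map (Rat.cast : ℚ → ℝ) = latticeGram Φ₁ η₁)
    (hE₁ : endAlgRat Φ₁ = ⊥) (hX₁ : ∀ k p, divisorClasses (powPeriod Φ₁ k) p = hodgeClasses (powPeriod Φ₁ k) p)
    (hcard : Fintype.card ι₂ ^ 2 ≤ Fintype.card l * (2 * Fintype.card l + 1))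
    (hX₂ : ∀ k p, divisorClasses (powPeriod Φ₂ k) p = hodgeClasses (powPeriod Φ₂ k) p) :
    ∀ k p, divisorClasses (powPeriod (prodPeriod Φ₁ Φ₂) k) p = hodgeClasses (powPeriod (prodPeriod Φ₁ Φ₂) k) p :=
  forall_divisorClasses_powPeriod_prod_eq_hodgeClasses_of_hodgeGroupC_prod_eq
    (hη₁.hodgeGroupC_prod_eq_blockDiagProd_of_endAlgRat_eq_bot_of_card_sq_le Φ₁ Φ₂ hG₁ hE₁ hX₁ hcard) hX₁ hX₂

/-- **`ρ(X₁ × X₂) = ρ(X₁) + ρ(X₂)`** under the same hypotheses (`Hom = 0`, Hulek–Laface Cor. 2.3).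
[cite: HulekLaface2019PicardNumbersAV, §2.1 Cor. 2.3] [cite: MoonenZarhin1999LowDim, §3 (3.1) and Prop. (3.8)] -/
theorem IsRiemannForm.finrank_neronSeveriGroup_prod_of_endAlgRat_eq_bot_of_card_sq_le [FiniteDimensional ℂ E₂]
    (hη₁ : IsRiemannForm Φ₁ η₁) (hG₁ : (Matrix.J l ℚ).map (Rat.cast : ℚ → ℝ) = latticeGram Φ₁ η₁)
    (hE₁ : endAlgRat Φ₁ = ⊥) (hX₁ : ∀ k p, divisorClasses (powPeriod Φ₁ k) p = hodgeClasses (powPeriod Φ₁ k) p)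
    (hcard : Fintype.card ι₂ ^ 2 ≤ Fintype.card l * (2 * Fintype.card l + 1)) :
    finrank ℤ (neronSeveriGroup (prodPeriod Φ₁ Φ₂)) = finrank ℤ (neronSeveriGroup Φ₁) + finrank ℤ (neronSeveriGroup Φ₂) := by
  have hA₁ : IsAbelianVariety Φ₁ := ⟨η₁, hη₁⟩
  exact hA₁.finrank_neronSeveriGroup_prod_of_homRat_eq_bot Φ₂
    (hη₁.homRat_eq_bot_of_endAlgRat_eq_bot_of_card_sq_le' Φ₁ Φ₂ hG₁ hE₁ hX₁ hcard)

variable {κ : Type*} [Fintype κ] [DecidableEq κ] {E' : Type u} [NormedAddCommGroup E'] [InnerProductSpace ℂ E']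
  [FiniteDimensional ℂ E'] [MeasurableSpace E'] [BorelSpace E'] (Ψ : (κ → ℝ) ≃L[ℝ] E') {q : ℕ} (e : Fin q ≃ κ)

/-- **The cycle form**: with `X₂` moreover an abelian variety, every inner-product torus `Y ∼ (X₁ × X₂)ᵏ` satisfies the
Hodge `(p,p)`-conjecture `Aᵖ(Y) = Bᵖ(Y)` in every codimension. [cite: Lange2023AbelianVarietiesComplex, §7.3.1 (p. 336) and §7.3.3 Exercise (1)(b)]
[cite: MoonenZarhin1999LowDim, §3 (3.1) and Thm. (3.2) (1)] -/
theorem IsIsogenous.forall_analyticClasses_eq_hodgeClasses_of_powPeriod_prod_of_card_sq_le {k : ℕ}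
    (hY : IsIsogenous Ψ (powPeriod (prodPeriod Φ₁ Φ₂) k)) (hη₁ : IsRiemannForm Φ₁ η₁)
    (hG₁ : (Matrix.J l ℚ).map (Rat.cast : ℚ → ℝ) = latticeGram Φ₁ η₁) (hE₁ : endAlgRat Φ₁ = ⊥)
    (hX₁ : ∀ k p, divisorClasses (powPeriod Φ₁ k) p = hodgeClasses (powPeriod Φ₁ k) p)
    (hcard : Fintype.card ι₂ ^ 2 ≤ Fintype.card l * (2 * Fintype.card l + 1)) (hA₂ : IsAbelianVariety Φ₂)
    (hX₂ : ∀ k p, divisorClasses (powPeriod Φ₂ k) p = hodgeClasses (powPeriod Φ₂ k) p) (p : ℕ) :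
    analyticClasses Ψ e p = hodgeClasses Ψ p := by
  have hA₁ : IsAbelianVariety Φ₁ := ⟨η₁, hη₁⟩
  exact hY.forall_analyticClasses_eq_hodgeClasses_of_forall_divisorClasses_eq Ψ e _ ((hA₁.prod hA₂).pow k)
    (hη₁.forall_divisorClasses_powPeriod_prod_eq_hodgeClasses_of_endAlgRat_eq_bot_of_card_sq_le Φ₁ Φ₂ hG₁ hE₁ hX₁
      hcard hX₂ k) p

end SmallFactor

/-! ## §2 Every abelian SURFACE against a Hodge-general factor of dimension `≥ 3` -/

section Surface

variable {l : Type*} [Fintype l] [DecidableEq l] [Nonempty l] {ι₂ : Type} [Fintype ι₂] [DecidableEq ι₂]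
  {E₁ : Type*} {E₂ : Type} [NormedAddCommGroup E₁] [NormedSpace ℂ E₁] [FiniteDimensional ℂ E₁] [NormedAddCommGroup E₂]
  [NormedSpace ℂ E₂] [FiniteDimensional ℂ E₂]
  (Φ₁ : ((l ⊕ l) → ℝ) ≃L[ℝ] E₁) (Φ₂ : (ι₂ → ℝ) ≃L[ℝ] E₂) {η₁ : E₁ [⋀^Fin 2]→L[ℝ] ℝ}

omit [DecidableEq l] [Nonempty l] [DecidableEq ι₂] [FiniteDimensional ℂ E₂] in
include Φ₂ in
/-- A two-dimensional complex torus has lattice rank `4`, and `4² ≤ g₁(2g₁+1)` for `g₁ ≥ 3`. [folklore]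
[cite: Lange2023AbelianVarietiesComplex, §1.1.2] -/
theorem card_sq_le_of_finrank_eq_two (h2 : finrank ℂ E₂ = 2) (hl : 3 ≤ Fintype.card l) :
    Fintype.card ι₂ ^ 2 ≤ Fintype.card l * (2 * Fintype.card l + 1) := by
  have h := finrank_complex_mul_two Φ₂ (Fintype.equivFin ι₂).symm
  rw [h2] at h
  have h4 : Fintype.card ι₂ = 4 := by omega
  rw [h4]
  nlinarith

omit [DecidableEq ι₂] [FiniteDimensional ℂ E₂] in
include Φ₂ in
/-- A two-dimensional complex torus has a non-empty lattice index type. [folklore] [cite: Lange2023AbelianVarietiesComplex, §1.1.2] -/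
theorem nonempty_of_finrank_eq_two (h2 : finrank ℂ E₂ = 2) : Nonempty ι₂ := by
  have h := finrank_complex_mul_two Φ₂ (Fintype.equivFin ι₂).symm
  rw [h2] at h
  exact Fintype.card_pos_iff.1 (by omega)

/-- **EVERY ABELIAN SURFACE `S` SPLITS OFF A STABLY NONDEGENERATE HODGE-GENERAL FACTOR `X₁` OF DIMENSION `g₁ ≥ 3`
(`End_ℚ(X₁) = ℚ`, Gram `J`): `Dᵖ((X₁ × S)ᵏ) = Bᵖ((X₁ × S)ᵏ)` for all `k, p`** — every abelian surface satisfies (D)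
(Moonen–Zarhin §3, the tree's `IsAbelianVariety.forall_divisorClasses_powPeriod_eq_hodgeClasses_of_finrank_eq_two`) and
`dim Hg(S) ≤ 15 < 21 ≤ g₁(2g₁+1)`. [cite: MoonenZarhin1999LowDim, §3 (3.1), Thm. (3.2) (1) and §3 (p0008 L108–L111)]
[cite: Gordon1999HodgeAVSurvey, Thm. 7.5 and Thm. 7.6.2] [cite: Gordon1997, §2.16 Proposition] -/
theorem IsRiemannForm.forall_divisorClasses_powPeriod_prod_eq_hodgeClasses_of_endAlgRat_eq_bot_of_finrank_eq_two
    (hη₁ : IsRiemannForm Φ₁ η₁) (hG₁ : (Matrix.J l ℚ).map (Rat.cast : ℚ → ℝ) = latticeGram Φ₁ η₁)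
    (hE₁ : endAlgRat Φ₁ = ⊥) (hX₁ : ∀ k p, divisorClasses (powPeriod Φ₁ k) p = hodgeClasses (powPeriod Φ₁ k) p)
    (hl : 3 ≤ Fintype.card l) (hS : IsAbelianVariety Φ₂) (h2 : finrank ℂ E₂ = 2) :
    ∀ k p, divisorClasses (powPeriod (prodPeriod Φ₁ Φ₂) k) p = hodgeClasses (powPeriod (prodPeriod Φ₁ Φ₂) k) p := by
  haveI := nonempty_of_finrank_eq_two Φ₂ h2
  exact hη₁.forall_divisorClasses_powPeriod_prod_eq_hodgeClasses_of_endAlgRat_eq_bot_of_card_sq_le Φ₁ Φ₂ hG₁ hE₁ hX₁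
    (card_sq_le_of_finrank_eq_two Φ₂ h2 hl) (hS.forall_divisorClasses_powPeriod_eq_hodgeClasses_of_finrank_eq_two h2)

omit [FiniteDimensional ℂ E₂] in
/-- **`Hom_ℚ(X₁, S) = 0` and `Hom_ℚ(S, X₁) = 0`** for every 2-dimensional torus `S` against such an `X₁` of dimension
`g₁ ≥ 3`. [cite: MoonenZarhin1999LowDim, §3 (3.1) and Prop. (3.8)] [cite: Gordon1997, §2.16 Proposition] -/
theorem IsRiemannForm.homRat_eq_bot_and_of_endAlgRat_eq_bot_of_finrank_eq_two (hη₁ : IsRiemannForm Φ₁ η₁)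
    (hG₁ : (Matrix.J l ℚ).map (Rat.cast : ℚ → ℝ) = latticeGram Φ₁ η₁) (hE₁ : endAlgRat Φ₁ = ⊥)
    (hX₁ : ∀ k p, divisorClasses (powPeriod Φ₁ k) p = hodgeClasses (powPeriod Φ₁ k) p) (hl : 3 ≤ Fintype.card l)
    (h2 : finrank ℂ E₂ = 2) : homRat Φ₁ Φ₂ = ⊥ ∧ homRat Φ₂ Φ₁ = ⊥ := by
  haveI := nonempty_of_finrank_eq_two Φ₂ h2
  exact ⟨hη₁.homRat_eq_bot_of_endAlgRat_eq_bot_of_card_sq_le Φ₁ Φ₂ hG₁ hE₁ hX₁ (card_sq_le_of_finrank_eq_two Φ₂ h2 hl),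
    hη₁.homRat_eq_bot_of_endAlgRat_eq_bot_of_card_sq_le' Φ₁ Φ₂ hG₁ hE₁ hX₁ (card_sq_le_of_finrank_eq_two Φ₂ h2 hl)⟩

/-- **`ρ(X₁ × S) = ρ(X₁) + ρ(S)`** for every 2-dimensional torus `S` against such an `X₁` of dimension `g₁ ≥ 3`.
[cite: HulekLaface2019PicardNumbersAV, §2.1 Cor. 2.3] [cite: MoonenZarhin1999LowDim, §3 Prop. (3.8)] -/
theorem IsRiemannForm.finrank_neronSeveriGroup_prod_of_endAlgRat_eq_bot_of_finrank_eq_two (hη₁ : IsRiemannForm Φ₁ η₁)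
    (hG₁ : (Matrix.J l ℚ).map (Rat.cast : ℚ → ℝ) = latticeGram Φ₁ η₁) (hE₁ : endAlgRat Φ₁ = ⊥)
    (hX₁ : ∀ k p, divisorClasses (powPeriod Φ₁ k) p = hodgeClasses (powPeriod Φ₁ k) p) (hl : 3 ≤ Fintype.card l)
    (h2 : finrank ℂ E₂ = 2) :
    finrank ℤ (neronSeveriGroup (prodPeriod Φ₁ Φ₂)) = finrank ℤ (neronSeveriGroup Φ₁) + finrank ℤ (neronSeveriGroup Φ₂) := by
  haveI := nonempty_of_finrank_eq_two Φ₂ h2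
  exact hη₁.finrank_neronSeveriGroup_prod_of_endAlgRat_eq_bot_of_card_sq_le Φ₁ Φ₂ hG₁ hE₁ hX₁
    (card_sq_le_of_finrank_eq_two Φ₂ h2 hl)

end Surface

/-! ## §3 The explicit abelian fivefolds `X_3^L × S`, `S` any abelian surface -/

section Liouville

variable {n : ℕ} (Φ : (Fin n ⊕ Fin n → ℝ) ≃L[ℝ] (Fin n → ℂ))
  (hΦ : ∀ v i, Φ v i = (v (Sum.inl i) : ℂ) + ∑ j, (I • (liouvillePeriodMatrix n).map ofReal) i j * (v (Sum.inr j) : ℂ))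
  {ι₂ : Type} [Fintype ι₂] [DecidableEq ι₂] {E₂ : Type} [NormedAddCommGroup E₂] [NormedSpace ℂ E₂]
  [FiniteDimensional ℂ E₂] (Φ₂ : (ι₂ → ℝ) ≃L[ℝ] E₂)

include hΦ in
/-- `End_ℚ = ℚ` for the Siegel presentation of `X_g^L` (row A4-115 along the isomorphism of row A4-118).
[cite: HulekLaface2019PicardNumbersAV, §6.2 Prop. 6.4] [cite: Lange2023AbelianVarietiesComplex, §3.1.5 Exercise (6)(a)] -/
theorem endAlgRat_eq_bot_of_forall_apply_liouville [NeZero n] : endAlgRat Φ = ⊥ :=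
  Subalgebra.eq_bot_of_finrank_one
    (by rw [(isIsogenous_liouvillePeriod_of_forall_apply Φ hΦ).finrank_endAlgRat_eq, finrank_endAlgRat_liouvillePeriod])

include hΦ in
/-- **FOR EVERY COMPLEX ABELIAN SURFACE `S`, EVERY POWER OF THE ABELIAN FIVEFOLD `X_3^L × S` HAS ITS HODGE RING GENERATED
BY DIVISOR CLASSES**: `Dᵖ((X_3^L × S)ᵏ) = Bᵖ((X_3^L × S)ᵏ)` for all `k, p` (`X_3^L` in its Siegel presentation
`x + iY_3^L y`: `End_ℚ = ℚ`, `Hg = Sp₆`, stably nondegenerate — rows A4-115/121/122; `S` satisfies (D) — Moonen–Zarhin;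
`dim Hg(S) ≤ 15 < 21 = dim Sp₆`). [cite: MoonenZarhin1999LowDim, §3 (3.1), Thm. (3.2) (1) and §3 (p0008 L108–L111)]
[cite: Gordon1999HodgeAVSurvey, Thm. 7.5 and Thm. 7.6.2] [cite: HulekLaface2019PicardNumbersAV, §6.2 Prop. 6.4] -/
theorem forall_divisorClasses_powPeriod_liouville_three_prod_eq_hodgeClasses_of_finrank_eq_two (hn : n = 3)
    (hS : IsAbelianVariety Φ₂) (h2 : finrank ℂ E₂ = 2) :
    ∀ k p, divisorClasses (powPeriod (prodPeriod Φ Φ₂) k) p = hodgeClasses (powPeriod (prodPeriod Φ Φ₂) k) p := by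
  subst hn
  exact (isPrincipalPolarization_liouvillePolarization_of_forall_apply Φ hΦ).isRiemannForm
    |>.forall_divisorClasses_powPeriod_prod_eq_hodgeClasses_of_endAlgRat_eq_bot_of_finrank_eq_two Φ Φ₂
    (ratCast_map_J_eq_latticeGram_liouvillePolarization_of_forall_apply Φ hΦ) (endAlgRat_eq_bot_of_forall_apply_liouville Φ hΦ)
    (forall_divisorClasses_powPeriod_eq_hodgeClasses_of_forall_apply_liouville Φ hΦ (by norm_num) le_rfl)
    (by rw [Fintype.card_fin]) hS h2

omit [FiniteDimensional ℂ E₂] in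
include hΦ in
/-- **`Hom_ℚ(X_3^L, S) = 0 = Hom_ℚ(S, X_3^L)` for every 2-dimensional complex torus `S`.**
[cite: MoonenZarhin1999LowDim, §3 (3.1) and Prop. (3.8)] [cite: Lange2023AbelianVarietiesComplex, §2.4.4 Cor. 2.4.26] -/
theorem homRat_liouville_three_eq_bot_of_finrank_eq_two (hn : n = 3) (h2 : finrank ℂ E₂ = 2) :
    homRat Φ Φ₂ = ⊥ ∧ homRat Φ₂ Φ = ⊥ := by
  subst hn
  exact (isPrincipalPolarization_liouvillePolarization_of_forall_apply Φ hΦ).isRiemannForm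
    |>.homRat_eq_bot_and_of_endAlgRat_eq_bot_of_finrank_eq_two Φ Φ₂
    (ratCast_map_J_eq_latticeGram_liouvillePolarization_of_forall_apply Φ hΦ) (endAlgRat_eq_bot_of_forall_apply_liouville Φ hΦ)
    (forall_divisorClasses_powPeriod_eq_hodgeClasses_of_forall_apply_liouville Φ hΦ (by norm_num) le_rfl)
    (by rw [Fintype.card_fin]) h2

include hΦ in
/-- **`ρ(X_3^L × S) = 1 + ρ(S)` for every 2-dimensional complex torus `S`** (so `ρ ∈ {1, …, 5}`, `= 1 + ρ(S)` with
`ρ(S) ∈ {0, …, 4}`; for abelian `S`, `ρ ∈ {2, 3, 4, 5}`). [cite: HulekLaface2019PicardNumbersAV, §2.1 Cor. 2.3 and §6.2 Prop. 6.4] -/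
theorem finrank_neronSeveriGroup_liouville_three_prod_of_finrank_eq_two (hn : n = 3) (h2 : finrank ℂ E₂ = 2) :
    finrank ℤ (neronSeveriGroup (prodPeriod Φ Φ₂)) = 1 + finrank ℤ (neronSeveriGroup Φ₂) := by
  subst hn
  rw [(isPrincipalPolarization_liouvillePolarization_of_forall_apply Φ hΦ).isRiemannForm
    |>.finrank_neronSeveriGroup_prod_of_endAlgRat_eq_bot_of_finrank_eq_two Φ Φ₂
    (ratCast_map_J_eq_latticeGram_liouvillePolarization_of_forall_apply Φ hΦ) (endAlgRat_eq_bot_of_forall_apply_liouville Φ hΦ)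
    (forall_divisorClasses_powPeriod_eq_hodgeClasses_of_forall_apply_liouville Φ hΦ (by norm_num) le_rfl)
    (by rw [Fintype.card_fin]) h2,
    (isIsogenous_liouvillePeriod_of_forall_apply Φ hΦ).finrank_neronSeveriGroup_eq Φ (liouvillePeriod 3),
    finrank_neronSeveriGroup_liouvillePeriod]

variable {κ : Type*} [Fintype κ] [DecidableEq κ] {E' : Type u} [NormedAddCommGroup E'] [InnerProductSpace ℂ E']
  [FiniteDimensional ℂ E'] [MeasurableSpace E'] [BorelSpace E'] (Ψ : (κ → ℝ) ≃L[ℝ] E') {q : ℕ} (e : Fin q ≃ κ)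

include hΦ in
/-- **THE HODGE `(p,p)`-CONJECTURE IN CYCLE FORM FOR EVERY INNER-PRODUCT TORUS ISOGENOUS TO A POWER OF `X_3^L × S`, `S`
ANY ABELIAN SURFACE**: `Aᵖ(Y) = Bᵖ(Y)` in every codimension `p`.
[cite: Lange2023AbelianVarietiesComplex, §7.3.1 (p. 336) and §7.3.3 Exercise (1)(b)] [cite: MoonenZarhin1999LowDim, §3 (3.1), Thm. (3.2) (1) and §3 (p0008 L108–L111)] -/
theorem IsIsogenous.forall_analyticClasses_eq_hodgeClasses_of_powPeriod_liouville_three_prod_of_finrank_eq_two {k : ℕ}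
    (hY : IsIsogenous Ψ (powPeriod (prodPeriod Φ Φ₂) k)) (hn : n = 3) (hS : IsAbelianVariety Φ₂) (h2 : finrank ℂ E₂ = 2)
    (p : ℕ) : analyticClasses Ψ e p = hodgeClasses Ψ p :=
  hY.forall_analyticClasses_eq_hodgeClasses_of_forall_divisorClasses_eq Ψ e _
    ((((isIsogenous_liouvillePeriod_of_forall_apply Φ hΦ).isAbelianVariety_iff.2 (isAbelianVariety_liouvillePeriod n)).prod
      hS).pow k)
    (forall_divisorClasses_powPeriod_liouville_three_prod_eq_hodgeClasses_of_finrank_eq_two Φ hΦ Φ₂ hn hS h2 k) p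

end Liouville

/-! ## §4 `X_g^L × E_τ` for every elliptic curve `E_τ`, `g ∈ {2, 3}` -/

section Elliptic

variable {n : ℕ} (Φ : (Fin n ⊕ Fin n → ℝ) ≃L[ℝ] (Fin n → ℂ))
  (hΦ : ∀ v i, Φ v i = (v (Sum.inl i) : ℂ) + ∑ j, (I • (liouvillePeriodMatrix n).map ofReal) i j * (v (Sum.inr j) : ℂ))
  {τ : ℂ} (hτ : τ.im ≠ 0)

include hΦ in
/-- **EVERY POWER OF `X_g^L × E_τ` (`g ∈ {2, 3}`, `E_τ` ANY ELLIPTIC CURVE, WITH OR WITHOUT COMPLEX MULTIPLICATION) HAS ITS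
HODGE RING GENERATED BY DIVISOR CLASSES** (`dim Hg(E_τ) ≤ 3 < 10 ≤ g(2g+1)`; Tate: `E_τ` satisfies (D)).
[cite: MoonenZarhin1999LowDim, §3 (3.1), Thm. (3.2) (1) and Cor. (3.9)] [cite: Gordon1999HodgeAVSurvey, Thm. 7.5 and Thm. 7.6.2]
[cite: Lange2023AbelianVarietiesComplex, §7.3.3 Exercise (3)(a)] [cite: HulekLaface2019PicardNumbersAV, §6.2 Prop. 6.4] -/
theorem forall_divisorClasses_powPeriod_liouville_prod_ellipticPeriod_eq_hodgeClasses (h2 : 2 ≤ n) (h3 : n ≤ 3) :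
    ∀ k p, divisorClasses (powPeriod (prodPeriod Φ (ellipticPeriod hτ)) k) p =
      hodgeClasses (powPeriod (prodPeriod Φ (ellipticPeriod hτ)) k) p := by
  haveI : NeZero n := ⟨by omega⟩
  haveI : Nonempty (Fin n) := ⟨⟨0, by omega⟩⟩
  refine (isPrincipalPolarization_liouvillePolarization_of_forall_apply Φ hΦ).isRiemannForm
    |>.forall_divisorClasses_powPeriod_prod_eq_hodgeClasses_of_endAlgRat_eq_bot_of_card_sq_le Φ (ellipticPeriod hτ)
    (ratCast_map_J_eq_latticeGram_liouvillePolarization_of_forall_apply Φ hΦ) (endAlgRat_eq_bot_of_forall_apply_liouville Φ hΦ)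
    (forall_divisorClasses_powPeriod_eq_hodgeClasses_of_forall_apply_liouville Φ hΦ h2 h3) ?_
    (fun k p ↦ divisorClasses_eq_hodgeClasses_ellipticPow hτ k p)
  rw [Fintype.card_fin, Fintype.card_fin]
  rcases (show n = 2 ∨ n = 3 by omega) with rfl | rfl <;> norm_num

include hΦ in
/-- **`Hom_ℚ(X_g^L, E_τ) = 0`, `ρ(X_g^L × E_τ) = 2`** (`g ∈ {2, 3}`, any `E_τ`).
[cite: HulekLaface2019PicardNumbersAV, §2.1 Cor. 2.3 and §6.2 Prop. 6.4] [cite: MoonenZarhin1999LowDim, §3 Prop. (3.8)] -/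
theorem finrank_neronSeveriGroup_liouville_prod_ellipticPeriod (h2 : 2 ≤ n) (h3 : n ≤ 3) :
    homRat Φ (ellipticPeriod hτ) = ⊥ ∧ finrank ℤ (neronSeveriGroup (prodPeriod Φ (ellipticPeriod hτ))) = 2 := by
  haveI : NeZero n := ⟨by omega⟩
  haveI : Nonempty (Fin n) := ⟨⟨0, by omega⟩⟩
  have hη := (isPrincipalPolarization_liouvillePolarization_of_forall_apply Φ hΦ).isRiemannForm
  have hG := ratCast_map_J_eq_latticeGram_liouvillePolarization_of_forall_apply Φ hΦ
  have hE := endAlgRat_eq_bot_of_forall_apply_liouville Φ hΦ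
  have hD := forall_divisorClasses_powPeriod_eq_hodgeClasses_of_forall_apply_liouville Φ hΦ h2 h3
  have hcard : Fintype.card (Fin 2) ^ 2 ≤ Fintype.card (Fin n) * (2 * Fintype.card (Fin n) + 1) := by
    rw [Fintype.card_fin, Fintype.card_fin]
    rcases (show n = 2 ∨ n = 3 by omega) with rfl | rfl <;> norm_num
  refine ⟨hη.homRat_eq_bot_of_endAlgRat_eq_bot_of_card_sq_le Φ (ellipticPeriod hτ) hG hE hD hcard, ?_⟩
  rw [hη.finrank_neronSeveriGroup_prod_of_endAlgRat_eq_bot_of_card_sq_le Φ (ellipticPeriod hτ) hG hE hD hcard,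
    (isIsogenous_liouvillePeriod_of_forall_apply Φ hΦ).finrank_neronSeveriGroup_eq Φ (liouvillePeriod n),
    finrank_neronSeveriGroup_liouvillePeriod, finrank_neronSeveriGroup_eq_one_of_finrank_eq_one (ellipticPeriod hτ) (finrank_self ℂ)]

variable {κ : Type*} [Fintype κ] [DecidableEq κ] {E' : Type u} [NormedAddCommGroup E'] [InnerProductSpace ℂ E']
  [FiniteDimensional ℂ E'] [MeasurableSpace E'] [BorelSpace E'] (Ψ : (κ → ℝ) ≃L[ℝ] E') {q : ℕ} (e : Fin q ≃ κ)

include hΦ in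
/-- **The Hodge `(p,p)`-conjecture in cycle form for every inner-product torus isogenous to a power of `X_g^L × E_τ`**
(`g ∈ {2, 3}`, any elliptic curve `E_τ`). [cite: Lange2023AbelianVarietiesComplex, §7.3.1 (p. 336) and §7.3.3 Exercise (1)(b)]
[cite: MoonenZarhin1999LowDim, §3 (3.1) and Cor. (3.9)] -/
theorem IsIsogenous.forall_analyticClasses_eq_hodgeClasses_of_powPeriod_liouville_prod_ellipticPeriod {k : ℕ}
    (hY : IsIsogenous Ψ (powPeriod (prodPeriod Φ (ellipticPeriod hτ)) k)) (h2 : 2 ≤ n) (h3 : n ≤ 3) (p : ℕ) :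
    analyticClasses Ψ e p = hodgeClasses Ψ p :=
  hY.forall_analyticClasses_eq_hodgeClasses_of_forall_divisorClasses_eq Ψ e _
    ((((isIsogenous_liouvillePeriod_of_forall_apply Φ hΦ).isAbelianVariety_iff.2 (isAbelianVariety_liouvillePeriod n)).prod
      (isAbelianVariety_ellipticPeriod hτ)).pow k)
    (forall_divisorClasses_powPeriod_liouville_prod_ellipticPeriod_eq_hodgeClasses Φ hΦ hτ h2 h3 k) p

end Elliptic

end ComplexTorus

end Literature.Geometry.Kaehler

end
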